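import Summits.CriticalPhenomena.CardyFormulaZ2.Theorems.CardyMagicRigidityMarkovCascadeDefs
import Literature.Probability.Percolation.LoopDensity
import Literature.Probability.Percolation.SiteLoopDensity
import HarnessLib

/-!
# Microscopic interface loops of both types of critical bond percolation on `δℤ²` are dense

Helper toward crux `NestingRigidity` (stmt-CriticalPhenomena-4835), line `markov-cascade-one-generation`:
the bond-`ℤ²` analogue of `tendsto_measure_setOf_sparse_siteLoopConfig` (`SiteLoopDensity.lean`, the
template). Type `1`: the counter-clockwise medial diamond around an isolated vertex (`vertexLoop`,
`isInterfaceLoop_vertexLoop`, `loopType_vertexLoop`); type `0`: the clockwise medial circuit inside a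
face with four open sides (`isInterfaceLoop_faceLoop`, `loopType_faceLoop`); both events have
probability `(1/2)^4` and disjoint supports along the rows `a + 3j e₀`; union bound over an `η/2`-net.
-/

noncomputable section

open MeasureTheory Set Filter
open scoped Topology BigOperators ENNReal Real

namespace Summit.CriticalPhenomena.CardyFormulaZ2.Cruxes.NestingRigidity.MarkovCascadeOneGeneration

open Literature.Probability.RandomPlanarGeometry Literature.Probability.Percolation
  Literature.Probability.LatticeModels
open Summit.CriticalPhenomena.CardyFormulaZ2.Theses.CardyMagicRigidity

/-! ### Type `1`: the medial diamond around an isolated vertex is counter-clockwise -/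

/-- The medial diamond `vertexLoop v` (east, north, west, south edge of `v`) has shoelace sum
`1 > 0` at mesh `1`, i.e. DKKMO type `1` (counter-clockwise). [folklore] -/
theorem loopType_vertexLoop (v : Site 2) : loopType (vertexLoop v) = 1 := by
  have h : loopSignedArea (vertexLoop v) = 1 := by
    simp [loopSignedArea, shoelace, vertexLoop, List.rotate_cons_succ, unitVec]
    ring
  rw [loopType, h, if_pos one_pos]

/-! ### Type `0`: the clockwise medial circuit inside a face with four open sides -/

/-- The four corners of the face `f` (lower-left corner `f`), clockwise from `f`:
`f`, `f + e₁`, `f + e₀ + e₁`, `f + e₀`. -/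
local notation3 "fc[" f "]" =>
  (![f, f + unitVec 1, f + unitVec 0 + unitVec 1, f + unitVec 0] : Fin 4 → Site 2)

/-- The face circuit of `f`: its bottom, left, top and right sides, i.e. the medial circuit
turning clockwise inside the face `f`. -/
local notation3 "faceLoop[" f "]" =>
  ([s(f, f + unitVec 0), s(f + unitVec 1, f), s(f + unitVec 0 + unitVec 1, f + unitVec 1),
    s(f + unitVec 0, f + unitVec 0 + unitVec 1)] : List MedialVertex)

/-- Each `fc[f] k` is a corner of the face `f`. [folklore] -/
theorem isCorner_fc (f : Site 2) (k : Fin 4) : IsCorner (fc[f] k) f := by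
  intro i
  fin_cases k <;> fin_cases i <;> simp [unitVec, Pi.add_apply]

/-- The medial darts of the four corners of the face `f`, clockwise inside the face:
`(bottom, left)`, `(left, top)`, `(top, right)`, `(right, bottom)`. [folklore] -/
theorem cornerSource_cornerTarget_fc (f : Site 2) :
    (cornerSource f f = s(f, f + unitVec 0) ∧ cornerTarget f f = s(f, f + unitVec 1)) ∧
    (cornerSource (f + unitVec 1) f = s(f + unitVec 1, f) ∧
      cornerTarget (f + unitVec 1) f = s(f + unitVec 1, f + unitVec 0 + unitVec 1)) ∧
    (cornerSource (f + unitVec 0 + unitVec 1) f = s(f + unitVec 0 + unitVec 1, f + unitVec 1) ∧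
      cornerTarget (f + unitVec 0 + unitVec 1) f = s(f + unitVec 0 + unitVec 1, f + unitVec 0)) ∧
    (cornerSource (f + unitVec 0) f = s(f + unitVec 0, f + unitVec 0 + unitVec 1) ∧
      cornerTarget (f + unitVec 0) f = s(f + unitVec 0, f)) := by
  have hn : cornerNeighbor f f 0 = f + unitVec 0 ∧ cornerNeighbor f f 1 = f + unitVec 1 ∧
      cornerNeighbor (f + unitVec 1) f 0 = f + unitVec 0 + unitVec 1 ∧ cornerNeighbor (f + unitVec 1) f 1 = f ∧
      cornerNeighbor (f + unitVec 0 + unitVec 1) f 0 = f + unitVec 1 ∧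
      cornerNeighbor (f + unitVec 0 + unitVec 1) f 1 = f + unitVec 0 ∧ cornerNeighbor (f + unitVec 0) f 0 = f ∧
      cornerNeighbor (f + unitVec 0) f 1 = f + unitVec 0 + unitVec 1 := by
    refine ⟨?_, ?_, ?_, ?_, ?_, ?_, ?_, ?_⟩ <;>
    · ext j
      fin_cases j <;> simp [cornerNeighbor, unitVec]
      all_goals ring
  obtain ⟨h00, h01, h10, h11, h20, h21, h30, h31⟩ := hn
  simp only [cornerSource, cornerTarget, cornerEdge, h00, h01, h10, h11, h20, h21, h30, h31]
  refine ⟨?_, ?_, ?_, ?_⟩ <;> simp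

/-- The entries of the face circuit are the sources of the four corner darts. [folklore] -/
theorem faceLoop_eq (f : Site 2) : faceLoop[f] =
    [cornerSource (fc[f] 0) f, cornerSource (fc[f] 1) f, cornerSource (fc[f] 2) f, cornerSource (fc[f] 3) f] := by
  obtain ⟨⟨h0, -⟩, ⟨h1, -⟩, ⟨h2, -⟩, ⟨h3, -⟩⟩ := cornerSource_cornerTarget_fc f
  simp [h0, h1, h2, h3]

/-- Consecutive corners of the face share a dart endpoint: the target of the `k`-th corner dart
is the source of the next (clockwise). [folklore] -/
theorem cornerTarget_fc_eq_cornerSource (f : Site 2) (k : Fin 4) :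
    cornerTarget (fc[f] k) f = cornerSource (fc[f] (k + 1)) f := by
  obtain ⟨⟨h0, h0'⟩, ⟨h1, h1'⟩, ⟨h2, h2'⟩, ⟨h3, h3'⟩⟩ := cornerSource_cornerTarget_fc f
  fin_cases k
  · simp [h0', h1]
  · simp [h1', h2]
  · simp [h2', h3]
  · simp [h3', h0]

/-- **The turning rule inside a face with open sides.** If the four sides of `f` are open,
consecutive corner darts of `f` satisfy the medial turning rule through its `f₁ = f₂` disjunct
(the circuit follows the open side, turning clockwise inside the face). [folklore] -/
theorem isMedialTurn_fc {ω : BondConfig (Site 2)} {f : Site 2} (hopen : ∀ e ∈ faceLoop[f], e ∈ ω)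
    (k : Fin 4) :
    IsMedialTurn ω (cornerSource (fc[f] k) f) (cornerSource (fc[f] (k + 1)) f)
      (cornerSource (fc[f] (k + 2)) f) := by
  have hk : k + 1 + 1 = k + 2 := by rw [add_assoc]; rfl
  refine ⟨fc[f] k, f, fc[f] (k + 1), f, isCorner_fc f k, rfl, cornerTarget_fc_eq_cornerSource f k,
    isCorner_fc f (k + 1), rfl, by rw [cornerTarget_fc_eq_cornerSource, hk],
    Or.inr ⟨rfl, hopen _ (by rw [faceLoop_eq]; fin_cases k <;> simp)⟩⟩

/-- **The face circuit of a face with four open sides is an interface loop** (the boundary of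
the singleton dual cluster `{f}`, an isolated dual vertex; its four sides are distinct, and the
turning rule is `isMedialTurn_fc`). [folklore] -/
theorem isInterfaceLoop_faceLoop {ω : BondConfig (Site 2)} {f : Site 2}
    (hopen : ∀ e ∈ faceLoop[f], e ∈ ω) : IsInterfaceLoop ω faceLoop[f] where
  ne_nil := by simp
  nodup := by
    refine List.Nodup.of_map Prod.fst ?_
    rw [List.map_fst_zip (by simp)]
    refine List.Nodup.of_map
      (Sym2.lift ⟨fun x y : Site 2 ↦ (x 0 + y 0, x 1 + y 1), fun x y ↦ by simp only [add_comm]⟩) ?_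
    simp [unitVec]
    omega
  turn := by
    intro i hi
    have key := isMedialTurn_fc hopen
    have h0 := key 0; have h1 := key 1; have h2 := key 2; have h3 := key 3
    simp only [faceLoop_eq] at hi ⊢
    simp only [List.length_cons, List.length_nil] at hi ⊢
    interval_cases i
    · simpa using h0
    · simpa using h1
    · simpa using h2
    · simpa using h3

/-- The face circuit has shoelace sum `-1 < 0` at mesh `1` (clockwise): DKKMO type `0`. [folklore] -/
theorem loopType_faceLoop (f : Site 2) : loopType faceLoop[f] = 0 := by
  have h : loopSignedArea faceLoop[f] = -1 := by
    simp [loopSignedArea, shoelace, List.rotate_cons_succ, unitVec]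
    ring
  rw [loopType, h, if_neg (by norm_num)]

/-- The midpoint of an edge joining two corners of the face `f`, at mesh `δ ≥ 0`, is within
`2δ` of the mesh point `δ f`. [folklore] -/
theorem dist_medialPoint_meshPoint_le {δ : ℝ} (hδ : 0 ≤ δ) {x y f : Site 2} (hx : IsCorner x f)
    (hy : IsCorner y f) : dist (medialPoint δ s(x, y)) (meshPoint δ f) ≤ 2 * δ := by
  have hc : ∀ {v : Site 2}, IsCorner v f → ∀ i, |((v i : ℤ) : ℝ) - f i| ≤ 1 := by
    intro v hv i
    rcases hv i with h | h <;> simp [h]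
  have key : ∀ s : ℝ, |s| ≤ 2 → |δ * s / 2| ≤ δ := fun s hs ↦ by
    rw [abs_div, abs_mul, abs_of_nonneg hδ, abs_two]; nlinarith
  rw [dist_eq_norm]
  refine (Complex.norm_le_abs_re_add_abs_im _).trans ?_
  have hre : (medialPoint δ s(x, y) - meshPoint δ f).re = δ * (((x 0 : ℝ) - f 0) + ((y 0 : ℝ) - f 0)) / 2 := by
    simp only [medialPoint_mk, Complex.sub_re, Complex.div_ofNat_re, Complex.add_re, meshPoint_re]; ring
  have him : (medialPoint δ s(x, y) - meshPoint δ f).im = δ * (((x 1 : ℝ) - f 1) + ((y 1 : ℝ) - f 1)) / 2 := by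
    simp only [medialPoint_mk, Complex.sub_im, Complex.div_ofNat_im, Complex.add_im, meshPoint_im]; ring
  rw [hre, him]
  have h0 := key _ ((abs_add_le _ _).trans
    (by linarith [hc hx 0, hc hy 0] : |(x 0 : ℝ) - f 0| + |(y 0 : ℝ) - f 0| ≤ 2))
  have h1 := key _ ((abs_add_le _ _).trans
    (by linarith [hc hx 1, hc hy 1] : |(x 1 : ℝ) - f 1| + |(y 1 : ℝ) - f 1| ≤ 2))
  linarith

/-- **The face circuit is microscopic**: its trace at mesh `δ ≥ 0` lies in
`closedBall (δ f) (2δ)` (a polyline lies in any convex set containing its vertices). [folklore] -/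
theorem range_loopCurve_faceLoop_subset {δ : ℝ} (hδ : 0 ≤ δ) (f : Site 2) :
    (loopCurve δ 0 faceLoop[f]).range ⊆ Metric.closedBall (meshPoint δ f) (2 * δ) := by
  refine range_loopCurve_zero_subset_of_convex δ (by simp) (convex_closedBall _ _) fun e he ↦ ?_
  simp only [List.mem_cons, List.not_mem_nil, or_false] at he
  rw [Metric.mem_closedBall]
  rcases he with rfl | rfl | rfl | rfl
  · exact dist_medialPoint_meshPoint_le hδ (isCorner_fc f 0) (isCorner_fc f 3)
  · exact dist_medialPoint_meshPoint_le hδ (isCorner_fc f 1) (isCorner_fc f 0)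
  · exact dist_medialPoint_meshPoint_le hδ (isCorner_fc f 2) (isCorner_fc f 1)
  · exact dist_medialPoint_meshPoint_le hδ (isCorner_fc f 3) (isCorner_fc f 2)

/-! ### The two events and the members of the typed loop configuration they produce -/

/-- The event "a microscopic loop of type `i` sits at `a`": `i = 1`: the four edges at the
vertex `a` are closed (`isolatedEvent`); `i = 0`: the four sides of the face `a` are open. -/
local notation3 "typEvent[" i ", " a "]" =>
  (if i = (1 : Fin 2) then isolatedEvent a else {ω : BondConfig (Site 2) | {e | e ∈ faceLoop[a]} ⊆ ω})

/-- **On `typEvent[i, a]` a lattice configuration has a member of type `i` of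
`bondLoopConfig δ 0 ω` with trace inside `closedBall (δ a) (2δ)`**: the face circuit
(`isInterfaceLoop_faceLoop`, type `0`), resp. the medial diamond (`isInterfaceLoop_vertexLoop`,
type `1`, trace in `closedBall (δ a) (δ/2)`). [folklore] -/
theorem exists_mem_bondLoopConfig_of_typEvent {δ : ℝ} (hδ : 0 ≤ δ) {ω : BondConfig (Site 2)}
    (hω : ω ⊆ (zdGraph 2).edgeSet) {i : Fin 2} {a : Site 2} (h : ω ∈ typEvent[i, a]) :
    ∃ u ∈ (bondLoopConfig δ 0 ω).F i, u.range ⊆ Metric.closedBall (meshPoint δ a) (2 * δ) := by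
  fin_cases i
  · simp only [Fin.zero_eta, Fin.isValue, zero_ne_one, ↓reduceIte, Set.mem_setOf_eq] at h
    have hil : IsInterfaceLoop ω faceLoop[a] := isInterfaceLoop_faceLoop fun e he ↦ h he
    exact ⟨UnbasedLoop.mk (BasedLoop.mk (loopCurve δ 0 faceLoop[a]) (isLoop_loopCurve δ 0 hil.ne_nil)),
      ⟨_, hil, loopType_faceLoop a, rfl⟩, range_loopCurve_faceLoop_subset hδ a⟩
  · simp only [Fin.mk_one, Fin.isValue, ↓reduceIte] at h
    have hil : IsInterfaceLoop ω (vertexLoop a) :=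
      isInterfaceLoop_vertexLoop hω fun e he ↦ h e (mem_starFinset.2 he)
    refine ⟨UnbasedLoop.mk (BasedLoop.mk (loopCurve δ 0 (vertexLoop a)) (isLoop_loopCurve δ 0 hil.ne_nil)),
      ⟨_, hil, loopType_vertexLoop a, rfl⟩, (range_loopCurve_vertexLoop_subset δ a).trans ?_⟩
    exact Metric.closedBall_subset_closedBall (by rw [abs_of_nonneg hδ]; linarith)

/-- The edges read by `typEvent[i, a]` (both types): the star of `a` and the sides of the face `a`. -/
local notation3 "supp[" a "]" => (starFinset a ∪ (faceLoop[a]).toFinset : Finset (Sym2 (Site 2)))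

/-- The cylinder event `{F ⊆ ω}` is determined by the edges of `F`. [folklore] -/
theorem determinedBy_setOf_subset (F : Set (Sym2 (Site 2))) : DeterminedBy {ω : BondConfig (Site 2) | F ⊆ ω} F := by
  rw [determinedBy_iff]
  intro ω ω' h
  exact ⟨fun hs e he ↦ ((Set.ext_iff.1 h e).1 ⟨hs he, he⟩).1, fun hs e he ↦ ((Set.ext_iff.1 h e).2 ⟨hs he, he⟩).1⟩

/-- The complement of `typEvent[i, a]` is determined by `supp[a]`. [folklore] -/
theorem determinedBy_compl_typEvent (i : Fin 2) (a : Site 2) :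
    DeterminedBy (typEvent[i, a])ᶜ (↑(supp[a]) : Set (Sym2 (Site 2))) := by
  refine DeterminedBy.compl ?_
  rw [Finset.coe_union, List.coe_toFinset]
  fin_cases i
  · simp only [Fin.zero_eta, Fin.isValue, zero_ne_one, ↓reduceIte]
    exact (determinedBy_setOf_subset _).mono Set.subset_union_right
  · simp only [Fin.mk_one, Fin.isValue, ↓reduceIte]
    exact (determinedBy_isolatedEvent a).mono Set.subset_union_left

/-- `typEvent[i, a]` is measurable. [folklore] -/
theorem measurableSet_typEvent (i : Fin 2) (a : Site 2) : MeasurableSet typEvent[i, a] :=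
  MeasurableSet.of_compl (determinedBy_compl_typEvent i a).measurableSet_of_finset

/-- **Both events have probability at least `1/16`** (exactly `(1/2)^4`: four closed edges,
`le_real_isolatedEvent`, resp. four open lattice edges, `bondPercolation_real_setOf_subset`). [folklore] -/
theorem le_real_typEvent (i : Fin 2) (a : Site 2) : (1 / 16 : ℝ) ≤ P2.real typEvent[i, a] := by
  fin_cases i
  · have hF : (↑(faceLoop[a]).toFinset : Set (Sym2 (Site 2))) ⊆ (zdGraph 2).edgeSet := by
      intro e he
      rw [List.coe_toFinset, Set.mem_setOf_eq, faceLoop_eq] at he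
      simp only [List.mem_cons, List.not_mem_nil, or_false] at he
      rcases he with rfl | rfl | rfl | rfl <;> exact cornerSource_mem_edgeSet (isCorner_fc a _)
    have h := bondPercolation_real_setOf_subset (zdGraph 2) half _ hF
    rw [List.coe_toFinset, coe_half] at h
    simp only [Fin.zero_eta, Fin.isValue, zero_ne_one, ↓reduceIte]
    rw [h]
    calc (1 / 16 : ℝ) = (1 / 2) ^ 4 := by norm_num
      _ ≤ (1 / 2) ^ (faceLoop[a]).toFinset.card :=
          pow_le_pow_of_le_one (by norm_num) (by norm_num) ((List.toFinset_card_le _).trans (by simp))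
  · simpa using le_real_isolatedEvent a

/-! ### Rows of well-separated sites: independence -/

/-- The endpoints of the edges of `supp[v]` have first coordinate within `1` of `v 0`. [folklore] -/
theorem abs_sub_le_one_of_mem_supp {v : Site 2} {e : Sym2 (Site 2)} (he : e ∈ supp[v]) {x : Site 2}
    (hx : x ∈ e) : |x 0 - v 0| ≤ 1 := by
  rw [Finset.mem_union, mem_starFinset, List.mem_toFinset] at he
  rcases he with he | he
  · obtain ⟨j, σ, hσ, rfl⟩ := exists_eq_of_mem_vertexLoop he
    rw [Sym2.mem_iff] at hx
    rcases hx with rfl | rfl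
    · simp
    · fin_cases j <;> rcases hσ with rfl | rfl <;> simp [unitVec]
  · simp only [List.mem_cons, List.not_mem_nil, or_false] at he
    rcases he with rfl | rfl | rfl | rfl <;> rw [Sym2.mem_iff] at hx <;> rcases hx with rfl | rfl <;>
      simp [unitVec]

/-- The supports of distinct row sites `rowSite a j = a + 3j e₀` are disjoint. [folklore] -/
theorem disjoint_supp_rowSite (a : Site 2) {j j' : ℕ} (h : j ≠ j') :
    Disjoint supp[rowSite a j] supp[rowSite a j'] := by
  rw [Finset.disjoint_left]
  intro e he he'
  have h1 := abs_sub_le_one_of_mem_supp he (Sym2.out_fst_mem e)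
  have h2 := abs_sub_le_one_of_mem_supp he' (Sym2.out_fst_mem e)
  rw [rowSite_apply_zero, abs_le] at h1 h2
  have : (j : ℤ) = j' := by omega
  exact h (by exact_mod_cast this)

/-- **Independence along a row**: the probability that none of the first `N` row sites carries
the event of type `i` is at most `(15/16)^N` (disjoint supports,
`bondPercolation_real_biInter_eq_prod`). [folklore] -/
theorem real_biInter_compl_typEvent_le (i : Fin 2) (a : Site 2) (N : ℕ) :
    P2.real (⋂ j ∈ Finset.range N, (typEvent[i, rowSite a j])ᶜ) ≤ (1 - 1 / 16) ^ N := by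
  have hprod := bondPercolation_real_biInter_eq_prod (zdGraph 2) half (Finset.range N)
    (fun j ↦ (typEvent[i, rowSite a j])ᶜ) (fun j ↦ (↑(supp[rowSite a j]) : Set (Sym2 (Site 2))))
    (fun j _ ↦ determinedBy_compl_typEvent i _) (fun j _ ↦ (measurableSet_typEvent i _).compl)
    (fun j _ j' _ hjj' ↦ Finset.disjoint_coe.2 (disjoint_supp_rowSite a hjj'))
  change (bondPercolation (zdGraph 2) half).real _ ≤ _
  rw [hprod, ← Finset.card_range N, ← Finset.prod_const, Finset.card_range]
  refine Finset.prod_le_prod (fun j _ ↦ measureReal_nonneg) fun j _ ↦ ?_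
  rw [measureReal_compl (measurableSet_typEvent i _), probReal_univ]
  have h := le_real_typEvent i (rowSite a j)
  change _ ≤ (bondPercolation (zdGraph 2) half).real _ at h
  linarith

/-- **The loops of a row stay near the point it was built for.** If `δ a` is within `δ` of `z`
and `3 N δ ≤ η/4`, then for `j < N` the closed `2δ`-ball about the `j`-th row site (at distance
`3 j δ` from `δ a`) lies in `ball z (η/2)`. [folklore] -/
theorem closedBall_rowSite_subset_ball {δ η : ℝ} (hδ : 0 < δ) {z : ℂ} {a : Site 2}
    (ha : dist (meshPoint δ a) z ≤ δ) {N j : ℕ} (hj : j < N) (hN : 3 * (N : ℝ) * δ ≤ η / 4) :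
    Metric.closedBall (meshPoint δ (rowSite a j)) (2 * δ) ⊆ Metric.ball z (η / 2) := by
  have hrow : dist (meshPoint δ (rowSite a j)) (meshPoint δ a) = 3 * j * δ := by
    have h : meshPoint δ (rowSite a j) - meshPoint δ a = ((3 * j * δ : ℝ) : ℂ) := by
      apply Complex.ext
      · simp only [Complex.sub_re, meshPoint_re, rowSite_apply_zero, Complex.ofReal_re]; push_cast; ring
      · simp only [Complex.sub_im, meshPoint_im, rowSite_apply_one, Complex.ofReal_im]; ring
    rw [Complex.dist_eq, h, Complex.norm_real, Real.norm_of_nonneg (by positivity)]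
  intro w hw
  rw [Metric.mem_closedBall] at hw
  rw [Metric.mem_ball]
  have hjN : (j : ℝ) + 1 ≤ N := by exact_mod_cast Nat.succ_le_of_lt hj
  calc dist w z ≤ dist w (meshPoint δ (rowSite a j)) + dist (meshPoint δ (rowSite a j)) (meshPoint δ a) +
        dist (meshPoint δ a) z := dist_triangle4 _ _ _ _
    _ ≤ 2 * δ + 3 * j * δ + δ := by rw [hrow]; gcongr
    _ < η / 2 := by nlinarith

/-! ### Assembly: microscopic loops of both types are dense with high probability -/

/-- **Fixed-mesh bound.** If the finite set `t` is an `η/2`-net of `closedBall 0 R₀`, then at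
mesh `δ > 0` the event "some point of `closedBall 0 R₀` has, for some type, no member of
`bondLoopConfig δ 0 ω` of that type inside its `η`-ball" has `P_{1/2}`-probability at most
`|t| · 2 · (15/16)^{⌊η/(12δ)⌋}` (the `⌊η/(12δ)⌋` row sites from the lattice point nearest to
`z' ∈ t` carry their loops inside `ball z' (η/2) ⊆ ball z η`; non-lattice configurations are null). [folklore] -/
theorem measure_setOf_sparse_bondLoopConfig_le {R₀ η : ℝ} (hη : 0 < η) {t : Finset ℂ}
    (hcover : Metric.closedBall (0 : ℂ) R₀ ⊆ ⋃ z' ∈ t, Metric.ball z' (η / 2)) {δ : ℝ} (hδ : 0 < δ) :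
    P2 {ω | ∃ z ∈ Metric.closedBall (0 : ℂ) R₀, ∃ i : Fin 2,
        ∀ u ∈ (bondLoopConfig δ 0 ω).F i, ¬ u.range ⊆ Metric.ball z η} ≤
      (t.card : ℝ≥0∞) * (2 * ENNReal.ofReal ((1 - 1 / 16) ^ ⌊η / (12 * δ)⌋₊)) := by
  set N := ⌊η / (12 * δ)⌋₊ with hN
  have hNδ : 3 * (N : ℝ) * δ ≤ η / 4 := by
    have h1 : (N : ℝ) ≤ η / (12 * δ) := Nat.floor_le (by positivity)
    rw [le_div_iff₀ (by positivity)] at h1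
    nlinarith
  set Bad : ℂ → Fin 2 → Set (BondConfig (Site 2)) :=
    fun z' i ↦ ⋂ j ∈ Finset.range N, (typEvent[i, rowSite (nearestSite δ z') j])ᶜ with hBad
  set L : Set (BondConfig (Site 2)) := {ω | ω ⊆ (zdGraph 2).edgeSet} with hL
  have hsub : {ω : BondConfig (Site 2) | ∃ z ∈ Metric.closedBall (0 : ℂ) R₀, ∃ i : Fin 2,
      ∀ u ∈ (bondLoopConfig δ 0 ω).F i, ¬ u.range ⊆ Metric.ball z η} ⊆ Lᶜ ∪ ⋃ z' ∈ t, ⋃ i : Fin 2, Bad z' i := by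
    rintro ω ⟨z, hz, i, hzi⟩
    refine or_iff_not_imp_left.2 fun hωL ↦ ?_
    rw [Set.mem_compl_iff, not_not] at hωL
    obtain ⟨z', hz't, hzz'⟩ := mem_iUnion₂.1 (hcover hz)
    refine mem_iUnion₂.2 ⟨z', hz't, mem_iUnion.2 ⟨i, ?_⟩⟩
    by_contra hnot
    simp only [hBad, mem_iInter, mem_compl_iff, not_forall, not_not] at hnot
    obtain ⟨j, hj, hωj⟩ := hnot
    obtain ⟨u, hu, hur⟩ := exists_mem_bondLoopConfig_of_typEvent hδ.le hωL hωj
    refine hzi u hu (hur.trans ((closedBall_rowSite_subset_ball hδ (dist_meshPoint_nearestSite_le hδ z')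
      (Finset.mem_range.1 hj) hNδ).trans (Metric.ball_subset_ball' ?_)))
    rw [Metric.mem_ball, dist_comm] at hzz'
    linarith
  have hLnull : P2 Lᶜ = 0 := by
    have hae : ∀ᵐ ω ∂P2, ω ⊆ (zdGraph 2).edgeSet := ProbabilityTheory.setBernoulli_ae_subset
    rw [ae_iff] at hae
    rwa [hL, Set.compl_setOf]
  calc _ ≤ P2 (Lᶜ ∪ ⋃ z' ∈ t, ⋃ i : Fin 2, Bad z' i) := measure_mono hsub
    _ ≤ P2 Lᶜ + P2 (⋃ z' ∈ t, ⋃ i : Fin 2, Bad z' i) := measure_union_le _ _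
    _ ≤ 0 + ∑ z' ∈ t, P2 (⋃ i : Fin 2, Bad z' i) := add_le_add hLnull.le (measure_biUnion_finset_le t _)
    _ ≤ ∑ z' ∈ t, ∑ i : Fin 2, P2 (Bad z' i) := by
        rw [zero_add]; exact Finset.sum_le_sum fun z' _ ↦ measure_iUnion_fintype_le _ _
    _ ≤ ∑ z' ∈ t, ∑ i : Fin 2, ENNReal.ofReal ((1 - 1 / 16) ^ N) := by
        refine Finset.sum_le_sum fun z' _ ↦ Finset.sum_le_sum fun i _ ↦ ?_
        rw [← ofReal_measureReal]
        exact ENNReal.ofReal_le_ofReal (real_biInter_compl_typEvent_le i (nearestSite δ z') N)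
    _ = (t.card : ℝ≥0∞) * (2 * ENNReal.ofReal ((1 - 1 / 16) ^ N)) := by
        rw [Finset.sum_const, Finset.sum_const, Finset.card_univ, Fintype.card_fin, nsmul_eq_mul,
          nsmul_eq_mul, Nat.cast_ofNat]

/-- **Microscopic interface loops of both types of critical bond percolation on `δℤ²` are dense
with high probability** (bond-`ℤ²` analogue of `tendsto_measure_setOf_sparse_siteLoopConfig`; Camia–Newman,
CMP 268 (2006), Thm 2 (ii), at the lattice level: isolated vertices and faces with four open sides are
everywhere). For every radius `R₀` and scale `η > 0`, the `P_{1/2}`-probability that some point `z` of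
`closedBall 0 R₀` has, for some type `i`, **no** member of type `i` of `bondLoopConfig δ 0 ω` (DKKMO's
`F_i`: interface loops of `ω` on `δℤ²` typed by the sign of the shoelace area) with trace inside `ball z η`
tends to `0` as `δ → 0⁺` (quantitatively `measure_setOf_sparse_bondLoopConfig_le`): the lattice input
matching the small loops in DKKMO's relation `d_CN ≤ ε` (`LoopConfig.IsClose`, no lower cut-off). [folklore] -/
theorem tendsto_measure_setOf_sparse_bondLoopConfig : ∀ (R₀ : ℝ) {η : ℝ}, 0 < η → Tendsto (fun δ : ℝ ↦ P2 {ω | ∃ z ∈ Metric.closedBall (0 : ℂ) R₀, ∃ i : Fin 2, ∀ u ∈ (bondLoopConfig δ 0 ω).F i, ¬ u.range ⊆ Metric.ball z η}) (𝓝[>] 0) (𝓝 0) := by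
  intro R₀ η hη
  obtain ⟨t₀, -, ht₀, hcover⟩ :=
    finite_cover_balls_of_compact (isCompact_closedBall (0 : ℂ) R₀) (half_pos hη)
  set t := ht₀.toFinset with ht
  have hcover' : Metric.closedBall (0 : ℂ) R₀ ⊆ ⋃ z' ∈ t, Metric.ball z' (η / 2) := by
    simpa only [ht, Set.Finite.mem_toFinset] using hcover
  have hN : Tendsto (fun δ : ℝ ↦ ⌊η / (12 * δ)⌋₊) (𝓝[>] 0) atTop := by
    refine tendsto_nat_floor_atTop.comp ?_
    refine (tendsto_inv_nhdsGT_zero.const_mul_atTop (show 0 < η / 12 by positivity)).congr fun δ ↦ ?_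
    rw [← div_div, div_eq_mul_inv (η / 12) δ]
  have hpow : Tendsto (fun δ : ℝ ↦ (1 - 1 / 16 : ℝ) ^ ⌊η / (12 * δ)⌋₊) (𝓝[>] 0) (𝓝 0) :=
    (tendsto_pow_atTop_nhds_zero_of_lt_one (by norm_num) (by norm_num)).comp hN
  have hlim : Tendsto (fun δ : ℝ ↦ (t.card : ℝ≥0∞) * (2 * ENNReal.ofReal ((1 - 1 / 16 : ℝ) ^ ⌊η / (12 * δ)⌋₊)))
      (𝓝[>] 0) (𝓝 0) := by
    simpa only [ENNReal.ofReal_zero, mul_zero] using ENNReal.Tendsto.const_mul (a := (t.card : ℝ≥0∞))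
      (ENNReal.Tendsto.const_mul (a := 2) (ENNReal.tendsto_ofReal hpow) (Or.inr ENNReal.ofNat_ne_top))
      (Or.inr (ENNReal.natCast_ne_top t.card))
  refine tendsto_of_tendsto_of_tendsto_of_le_of_le' tendsto_const_nhds hlim
    (Eventually.of_forall fun _ ↦ bot_le) ?_
  filter_upwards [self_mem_nhdsWithin] with δ hδ
  exact measure_setOf_sparse_bondLoopConfig_le hη hcover' hδ

end Summit.CriticalPhenomena.CardyFormulaZ2.Cruxes.NestingRigidity.MarkovCascadeOneGeneration

end
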